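import Literature.AnabelianGeometry.EtaleTheta.ThetaCoversModelPiC
import HarnessLib

/-!
# [EtTh] §2 over §1: the binder «`I_x ⥲ Δ̄_Θ`» (`hIx`, GAP-LEDGER G-L2t10-3) REDUCED to a clause on the
# §1 datum `Π^tp_X ⊇ D_x` alone

S. Mochizuki, *The étale theta function and its Frobenioid-theoretic manifestations*, Publ. RIMS **45**
(2009) [EtTh], §2, discussion preceding Def. 2.1, p. 35 (printed 261): «a natural injective [outer]
homomorphism `D_x → Π^Θ_X` … which maps the inertia group `I_x ⊆ D_x` isomorphically onto `Δ̄_Θ`» — for a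
cusp `x` of `X^log`, where `Δ̄_Θ = [Δ̄_X, Δ̄_X] ≅ ℤ/lℤ` [cite: MochizukiEtTh2009, Def 2.1 p.35].

Cell abc-iut, layer L2, seat abc-iut-L2-t10 (gen 5; lineage of `ThetaCoversModelPiC` / `ThetaCoversAxOfSetting`).
The constructor `ThetaSetting.PiCData.coverDataAx` takes the printed input P-C3 as the BINDER
`hIx : (I.Dx x ⊓ I.augGK.ker) ⊔ I.barKer l = I.barTheta l` inside the profinite `Π_C` (GAP-LEDGER
G-L2t10-3: a property of the POSITION of the cusp's inertia in `Δ_X`, which the §1 interface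
`TemperedCurve`/`ThetaSetting` does not record — it gives `I_x ≅ Ẑ(1)` abstractly only). Since `D_x`,
`barKer`, `barTheta` of the bundle `I : D.PiCData PiC` are by construction the images under the injective
`Π_X ↪ Π_C` of §1 objects, the binder does not concern `Π_C` at all. PROOF-ONLY file (0 definitions):

* §1 `PiCData.map_inf_ker_augGK` — `incl(A) ∩ Ker(Π_C ↠ G_K) = incl(A ∩ Ker(Π_X ↠ G_K))` (`aug ∘ incl =
  augHat`); `PiCData.Dx_inf_ker_eq_map`;
* §2 **`PiCData.inertia_sup_barKer_iff`**: `hIx ↔ (D̂_x ⊓ Ker augHat) ⊔ barKerHat l = barThetaHat l` in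
  `Π_X`, with `D̂_x :=` the closure of `toHat(D_x)` — G-L2t10-3 REDUCED to the §1 side (given (P1) through the
  once-punctured parameters, as the binder's home `coverDataAx` is); `inertia_sup_barKer_of_hat` (the
  direction consumers use);
* §3 when the decomposition group is COMPACT (as `Ẑ(1) ⋊ G_K` is; e.g. the cusp datum of the χ-model,
  `SettingModelChiCusp`): `D̂_x = toHat(D_x)` and `toHat(D_x) ⊓ Ker augHat = toHat(I_x)` with `I_x =
  D.inertia x = D_x ∩ Δ^tp_X`, so **`PiCData.inertia_sup_barKer_iff_inertia`**: `hIx ↔ toHat(I_x) ⊔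
  barKerHat l = barThetaHat l` — «the inertia of the cusp topologically generates `Δ̄_Θ` modulo
  `Ker(Δ_X ↠ Δ̄_X)`», the shape GAP-LEDGER l.250/l.273 proposes for the v-next §1 interface clause
  («for a free basis `a, b` of `Δ_X` the inertia is `⟨[a,b]⟩^Ẑ`» implies it for every `l`).

HONEST LIMITS: a reduction, not a discharge — no model in the tree satisfies the clause (the χ-model's
synthetic cusp has TORAL inertia `b^Ẑ`, which maps trivially to `Δ_Θ`: `SettingModelCuspAxis.lean`,
honest label); nothing of [EtTh] is asserted; no new `Prop` fact; zero edit of any other seat's file; no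
side is taken on [IUTchIII] Cor. 3.12; typed ≠ proved.
-/

noncomputable section

namespace Literature.AnabelianGeometry.EtaleTheta

open _root_.Topology Literature.AnabelianGeometry.SemiGraphs

namespace ThetaSetting.PiCData

variable {p : ℕ} [Fact p.Prime] {D : ThetaSetting p} {PiC : Type} [Group PiC] [TopologicalSpace PiC]
  [IsTopologicalGroup PiC] [T2Space PiC] (I : D.PiCData PiC) (l : ℕ)

/-! ## §1. Transport of `∩ Ker(↠ G_K)` along `Π_X ↪ Π_C` -/

/-- `incl(A) ∩ Ker(Π_C ↠ G_K) = incl(A ∩ Ker(Π_X → G_{ℚ_p}))` for every `A ≤ Π_X` (`aug ∘ incl = augHat`).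
[cite: MochizukiEtTh2009, Def 2.1 p.36] -/
theorem map_inf_ker_augGK (A : Subgroup D.PiHat) :
    A.map I.incl.toMonoidHom ⊓ I.augGK.ker = (A ⊓ D.augHat.toMonoidHom.ker).map I.incl.toMonoidHom := by
  ext z
  simp only [Subgroup.mem_inf, Subgroup.mem_map, MonoidHom.mem_ker]
  constructor
  · rintro ⟨⟨y, hy, rfl⟩, hz⟩
    refine ⟨y, ⟨hy, ?_⟩, rfl⟩
    have h : I.aug (I.incl y) = 1 := I.mem_ker_augGK.1 hz
    rwa [I.aug_incl] at h
  · rintro ⟨y, ⟨hy, hy1⟩, rfl⟩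
    refine ⟨⟨y, hy, rfl⟩, I.mem_ker_augGK.2 ?_⟩
    change I.aug (I.incl y) = 1
    rw [I.aug_incl]
    exact hy1

/-- **`D_x ∩ Δ_C` inside `Π_C` is the image of `D̂_x ∩ Ker(Π_X → G_{ℚ_p})`**, `D̂_x` the closure of
`toHat(D_x)` in `Π_X`. [cite: MochizukiEtTh2009, Def 2.1 p.35] -/
theorem Dx_inf_ker_eq_map (x : D.Pt) :
    I.Dx x ⊓ I.augGK.ker =
      (((D.decomp x).map D.toHat.toMonoidHom).topologicalClosure ⊓ D.augHat.toMonoidHom.ker).map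
        I.incl.toMonoidHom :=
  I.map_inf_ker_augGK _

/-! ## §2. The binder `hIx` is a statement inside `Π_X` -/

/-- **G-L2t10-3 REDUCED to the §1 side**: the binder `hIx` of `PiCData.coverDataAx` («`I_x ⥲ Δ̄_Θ`»:
`(D_x ∩ Δ_C) · Ker(Δ_X ↠ Δ̄_X) = Δ̄_Θ`-preimage inside `Π_C`) is EQUIVALENT to the same identity inside the
profinite completion `Π_X` of the §1 datum: `(D̂_x ∩ Ker augHat) ⊔ barKerHat l = barThetaHat l` (all three
subgroups of `Π_C` are images under the injective `incl`, given (P1) through `e`).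
[cite: MochizukiEtTh2009, Def 2.1 p.35] -/
theorem inertia_sup_barKer_iff (e : D.OncePuncturedData) (x : D.Pt) :
    (I.Dx x ⊓ I.augGK.ker) ⊔ I.barKer l = I.barTheta l ↔
      ((D.decomp x).map D.toHat.toMonoidHom).topologicalClosure ⊓ D.augHat.toMonoidHom.ker ⊔ D.barKerHat l =
        D.barThetaHat l := by
  rw [I.Dx_inf_ker_eq_map, I.barKer_eq_map l e, I.barTheta_eq_map l e, ← Subgroup.map_sup]
  exact (Subgroup.map_injective I.incl_injective).eq_iff

/-- The direction consumers use: the §1-side identity gives the binder `hIx` of `coverDataAx`.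
[cite: MochizukiEtTh2009, Def 2.1 p.35] -/
theorem inertia_sup_barKer_of_hat (e : D.OncePuncturedData) (x : D.Pt)
    (h : ((D.decomp x).map D.toHat.toMonoidHom).topologicalClosure ⊓ D.augHat.toMonoidHom.ker ⊔ D.barKerHat l =
      D.barThetaHat l) :
    (I.Dx x ⊓ I.augGK.ker) ⊔ I.barKer l = I.barTheta l :=
  (I.inertia_sup_barKer_iff l e x).2 h

end ThetaSetting.PiCData

/-! ## §3. Compact decomposition groups: the clause in terms of the inertia subgroup `I_x ⊆ Π^tp_X` -/

namespace ThetaSetting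

variable {p : ℕ} [Fact p.Prime] (D : ThetaSetting p) (l : ℕ)

/-- For a COMPACT decomposition group, `toHat(D_x)` is closed in `Π_X` (compact image in a Hausdorff
group), so `D̂_x = toHat(D_x)`. [cite: MochizukiEtTh2009, Def 2.1 p.35] -/
theorem closure_map_decomp_eq_of_isCompact (x : D.Pt) (hcpt : IsCompact (D.decomp x : Set D.PiTemp)) :
    ((D.decomp x).map D.toHat.toMonoidHom).topologicalClosure = (D.decomp x).map D.toHat.toMonoidHom := by
  haveI : T2Space D.PiHat := D.isProfiniteCompletion_toHat.t2Space
  refine le_antisymm (Subgroup.topologicalClosure_minimal _ le_rfl ?_) (Subgroup.le_topologicalClosure _)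
  rw [Subgroup.coe_map]
  exact (hcpt.image D.toHat.continuous).isClosed

/-- `toHat(D_x) ∩ Ker(Π_X → G_{ℚ_p}) = toHat(I_x)` with `I_x = D_x ∩ Δ^tp_X` the inertia subgroup
(`augHat ∘ toHat = aug`). [cite: MochizukiEtTh2009, Def 2.1 p.35] -/
theorem map_decomp_inf_ker_augHat (x : D.Pt) :
    (D.decomp x).map D.toHat.toMonoidHom ⊓ D.augHat.toMonoidHom.ker = (D.inertia x).map D.toHat.toMonoidHom := by
  ext z
  simp only [Subgroup.mem_inf, Subgroup.mem_map, MonoidHom.mem_ker, TemperedCurve.inertia,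
    TemperedCurve.DeltaTemp]
  constructor
  · rintro ⟨⟨y, hy, rfl⟩, hz⟩
    refine ⟨y, ⟨hy, ?_⟩, rfl⟩
    change D.augHat (D.toHat y) = 1 at hz
    rwa [D.augHat_comp] at hz
  · rintro ⟨y, ⟨hy, hy1⟩, rfl⟩
    refine ⟨⟨y, hy, rfl⟩, ?_⟩
    change D.augHat (D.toHat y) = 1
    rw [D.augHat_comp]
    exact hy1

/-- Hence, for a compact decomposition group, the §1-side clause reads
`toHat(I_x) ⊔ barKerHat l = barThetaHat l`. [cite: MochizukiEtTh2009, Def 2.1 p.35] -/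
theorem hatClause_iff_inertia_of_isCompact (x : D.Pt) (hcpt : IsCompact (D.decomp x : Set D.PiTemp)) :
    ((D.decomp x).map D.toHat.toMonoidHom).topologicalClosure ⊓ D.augHat.toMonoidHom.ker ⊔ D.barKerHat l =
        D.barThetaHat l ↔
      (D.inertia x).map D.toHat.toMonoidHom ⊔ D.barKerHat l = D.barThetaHat l := by
  rw [D.closure_map_decomp_eq_of_isCompact x hcpt, D.map_decomp_inf_ker_augHat x]

namespace PiCData

variable {D} {PiC : Type} [Group PiC] [TopologicalSpace PiC] [IsTopologicalGroup PiC] [T2Space PiC]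
  (I : D.PiCData PiC)

/-- **G-L2t10-3 at a compact decomposition group**: the binder `hIx` of `coverDataAx` is EQUIVALENT to
«the inertia subgroup `I_x ⊆ Π^tp_X` of the cusp topologically generates `Δ̄_Θ` modulo `Ker(Δ_X ↠ Δ̄_X)`»:
`toHat(I_x) ⊔ barKerHat l = barThetaHat l` — a clause on the §1 datum alone.
[cite: MochizukiEtTh2009, Def 2.1 p.35] -/
theorem inertia_sup_barKer_iff_inertia (e : D.OncePuncturedData) (x : D.Pt)
    (hcpt : IsCompact (D.decomp x : Set D.PiTemp)) :
    (I.Dx x ⊓ I.augGK.ker) ⊔ I.barKer l = I.barTheta l ↔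
      (D.inertia x).map D.toHat.toMonoidHom ⊔ D.barKerHat l = D.barThetaHat l := by
  rw [I.inertia_sup_barKer_iff l e x, D.hatClause_iff_inertia_of_isCompact l x hcpt]

/-- The direction consumers use, compact case. [cite: MochizukiEtTh2009, Def 2.1 p.35] -/
theorem inertia_sup_barKer_of_inertia (e : D.OncePuncturedData) (x : D.Pt)
    (hcpt : IsCompact (D.decomp x : Set D.PiTemp))
    (h : (D.inertia x).map D.toHat.toMonoidHom ⊔ D.barKerHat l = D.barThetaHat l) :
    (I.Dx x ⊓ I.augGK.ker) ⊔ I.barKer l = I.barTheta l :=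
  (I.inertia_sup_barKer_iff_inertia l e x hcpt).2 h

end PiCData

end ThetaSetting

end Literature.AnabelianGeometry.EtaleTheta

end
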